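import Literature.AlgebraicGeometry.Frobenioids.DirectSumMonoids
import HarnessLib

/-!
# Frobenioids I, §0 / Def. 2.4 (i)(b): the primes of a direct sum `⊕_i M_i` of monoprime monoids

Mochizuki, *The geometry of Frobenioids I*, Kyushu J. Math. **62** (2008), §0 p. 12 (primary elements, primes
`Prime(M)`, `M_𝔭`), Def. 2.4 (i)(b) p. 47 ("every `M_𝔭` is monoprime"), Ex. 6.1 p. 109 / Ex. 6.3 p. 113 ("there is
a natural bijection `Prime(Φ(L)) ≃ V(L)`") [cite: MochizukiFrdI2008, §0 p.12] [cite: MochizukiFrdI2008, Ex. 6.3 p.113].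

For a direct sum `⊕_i M_i` (`DirectSumMonoids.lean`) of MONOPRIME monoids: an element is primary iff its
support is a single index (`isPrimary_iff`); two primaries are `≼`-equivalent iff they have the same support;
hence **`Prime(⊕_i M_i) ≃ ι`** (`primesEquiv`: `𝔭 ↦` the supporting index, `i ↦` the class of any `single i ε`,
`ε ≠ 1`), the subset of the prime of `i` is `{f | supp f = {i}}`, the submonoid `(⊕ M)_𝔭` it generates is
`{f | supp f ⊆ {i}} ≅ M_i` (`submonoidEquiv`), so **every `(⊕_i M_i)_𝔭` is monoprime** (Def. 2.4 (i)(b)).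
Seat abc-iut-L1-d2 (cell abc-iut); sub-DAG row FrdI:Thm6.4(i)/T64i-L02.
-/

noncomputable section

namespace Literature.AlgebraicGeometry.Frobenioids

open Function Literature.AnabelianGeometry.EtaleTheta

universe u v

/-- `IsMonoprime` transports along an isomorphism of monoids living in DIFFERENT universes (the tree's
`IsMonoprime.of_mulEquiv` is the same-universe case). [cite: MochizukiFrdI2008, §0 p.10] -/
theorem IsMonoprime.of_mulEquiv_univ {N : Type u} {N' : Type v} [CommMonoid N] [CommMonoid N'] (e : N ≃* N')
    (h : IsMonoprime N) : IsMonoprime N' := by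
  rcases h with ⟨⟨⟨f⟩⟩⟩ | ⟨⟨⟨f⟩⟩⟩ | ⟨⟨⟨f⟩⟩⟩
  · exact .ofZ ⟨⟨e.symm.trans f⟩⟩
  · exact .ofQ ⟨⟨e.symm.trans f⟩⟩
  · exact .ofR ⟨⟨e.symm.trans f⟩⟩

namespace DirectSum

variable {ι : Type u} {M : ι → Type v} [∀ i, CommMonoid (M i)] [DecidableEq ι]
  (hM : ∀ i, IsMonoprime (M i))
include hM

/-! ### Primary elements: support a single index -/

/-- **An element of `⊕_i M_i` (monoprime factors) is primary iff its support is a single index.**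
[cite: MochizukiFrdI2008, §0 p.12] -/
theorem isPrimary_iff (f : directSum M) : IsPrimary f ↔ ∃ i, dsupp (f : ∀ j, M j) = {i} := by
  constructor
  · intro hf
    obtain ⟨i, hi⟩ := (ne_one_iff_dsupp_nonempty f).mp hf.1
    refine ⟨i, Set.Subset.antisymm ?_ (Set.singleton_subset_iff.mpr hi)⟩
    -- `single i (f i) ≼ f`, hence `f ≼ single i (f i)`, so `supp f ⊆ {i}`
    have hne : single i ((f : ∀ j, M j) i) ≠ 1 := by
      rw [ne_one_iff_dsupp_nonempty, dsupp_single hi]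
      exact Set.singleton_nonempty i
    have hle : single i ((f : ∀ j, M j) i) ≼ f := by
      rw [precsim_iff_dsupp_subset hM, dsupp_single hi, Set.singleton_subset_iff]
      exact hi
    have := hf.2 _ hne hle
    rw [precsim_iff_dsupp_subset hM, dsupp_single hi] at this
    exact this
  · rintro ⟨i, hi⟩
    refine ⟨(ne_one_iff_dsupp_nonempty f).mpr (by rw [hi]; exact Set.singleton_nonempty i), fun b hb hbf => ?_⟩
    rw [precsim_iff_dsupp_subset hM] at hbf ⊢
    rw [hi] at hbf ⊢
    obtain ⟨j, hj⟩ := (ne_one_iff_dsupp_nonempty b).mp hb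
    have hji : j = i := hbf hj
    subst hji
    exact Set.singleton_subset_iff.mpr hj

/-- `≼`-equivalent primaries have the same support. [cite: MochizukiFrdI2008, §0 p.12] -/
theorem dsupp_eq_of_precsim {a b : directSum M} (ha : IsPrimary a) (hb : IsPrimary b) (hab : a ≼ b) :
    dsupp (a : ∀ j, M j) = dsupp (b : ∀ j, M j) := by
  obtain ⟨i, hi⟩ := (isPrimary_iff hM a).mp ha
  obtain ⟨j, hj⟩ := (isPrimary_iff hM b).mp hb
  have h := (precsim_iff_dsupp_subset hM a b).mp hab
  rw [hi, hj, Set.singleton_subset_singleton] at h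
  rw [hi, hj, h]

/-! ### `Prime(⊕_i M_i) ≃ ι` -/

/-- The index supporting a primary element. [cite: MochizukiFrdI2008, §0 p.12] -/
def suppIndex (a : primaries (directSum M)) : ι :=
  Classical.choose ((isPrimary_iff hM a.1).mp a.2)

/-- `supp a = {suppIndex a}`. [cite: MochizukiFrdI2008, §0 p.12] -/
theorem dsupp_eq_suppIndex (a : primaries (directSum M)) : dsupp (a.1 : ∀ j, M j) = {suppIndex hM a} :=
  Classical.choose_spec ((isPrimary_iff hM a.1).mp a.2)

/-- `Prime(⊕_i M_i) → ι`: the supporting index of (any representative of) a class.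
[cite: MochizukiFrdI2008, §0 p.12] -/
def idx : Primes (directSum M) → ι :=
  Quotient.lift (suppIndex hM) fun a b hab => by
    have := dsupp_eq_of_precsim hM a.2 b.2 hab
    rw [dsupp_eq_suppIndex hM, dsupp_eq_suppIndex hM, Set.singleton_eq_singleton_iff] at this
    exact this

/-- `idx` on a class. [cite: MochizukiFrdI2008, §0 p.12] -/
theorem idx_mk (a : directSum M) (ha : IsPrimary a) :
    dsupp (a : ∀ j, M j) = {idx hM (Quotient.mk (primarySetoid (directSum M)) ⟨a, ha⟩)} :=
  dsupp_eq_suppIndex hM ⟨a, ha⟩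

omit [DecidableEq ι] in
/-- A chosen non-unit of the monoprime monoid `M i`. [cite: MochizukiFrdI2008, §0 p.10] -/
def gen (i : ι) : M i := Classical.choose (MonoprimeStructure.exists_ne_one (hM i))

omit [DecidableEq ι] in
/-- `gen i ≠ 1`. [cite: MochizukiFrdI2008, §0 p.10] -/
theorem gen_ne_one (i : ι) : gen hM i ≠ 1 := Classical.choose_spec (MonoprimeStructure.exists_ne_one (hM i))

/-- `single i (gen i)` is primary. [cite: MochizukiFrdI2008, §0 p.12] -/
theorem isPrimary_single_gen (i : ι) : IsPrimary (single i (gen hM i) : directSum M) :=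
  (isPrimary_iff hM _).mpr ⟨i, dsupp_single (gen_ne_one hM i)⟩

/-- `ι → Prime(⊕_i M_i)`: the class of `single i ε` for a non-unit `ε` of `M_i`.
[cite: MochizukiFrdI2008, §0 p.12] -/
def primeOf (i : ι) : Primes (directSum M) :=
  Quotient.mk (primarySetoid (directSum M)) ⟨single i (gen hM i), isPrimary_single_gen hM i⟩

/-- `idx (primeOf i) = i`. [cite: MochizukiFrdI2008, §0 p.12] -/
theorem idx_primeOf (i : ι) : idx hM (primeOf hM i) = i := by
  have h1 := idx_mk hM (single i (gen hM i)) (isPrimary_single_gen hM i)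
  rw [dsupp_single (gen_ne_one hM i), Set.singleton_eq_singleton_iff] at h1
  exact h1.symm

/-- `primeOf (idx 𝔭) = 𝔭`. [cite: MochizukiFrdI2008, §0 p.12] -/
theorem primeOf_idx (P : Primes (directSum M)) : primeOf hM (idx hM P) = P := by
  induction P using Quotient.inductionOn with
  | h a =>
    apply Quotient.sound
    show single _ _ ≼ a.1
    rw [precsim_iff_dsupp_subset hM, dsupp_single (gen_ne_one hM _), dsupp_eq_suppIndex hM a]
    rfl

/-- **`Prime(⊕_i M_i) ≃ ι`** ("a natural bijection `Prime(Φ(L)) ≃ V(L)`", Ex. 6.3).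
[cite: MochizukiFrdI2008, Ex. 6.3 p.113] -/
def primesEquiv : Primes (directSum M) ≃ ι where
  toFun := idx hM
  invFun := primeOf hM
  left_inv := primeOf_idx hM
  right_inv := idx_primeOf hM

/-- The subset of the prime of `i`: the elements supported exactly at `i`. [cite: MochizukiFrdI2008, §0 p.12] -/
theorem mem_carrier_primeOf_iff (i : ι) (a : directSum M) :
    a ∈ (primeOf hM i).carrier ↔ dsupp (a : ∀ j, M j) = {i} := by
  constructor
  · rintro ⟨ha, hP⟩
    rw [idx_mk hM a ha, hP, idx_primeOf]
  · intro hs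
    have ha : IsPrimary a := (isPrimary_iff hM a).mpr ⟨i, hs⟩
    refine ⟨ha, ?_⟩
    have h1 := idx_mk hM a ha
    rw [hs, Set.singleton_eq_singleton_iff] at h1
    rw [← primeOf_idx hM (Quotient.mk (primarySetoid (directSum M)) ⟨a, ha⟩), ← h1]

/-- **The submonoid `(⊕_i M_i)_𝔭` of the prime of `i` is `{a | supp a ⊆ {i}}`.**
[cite: MochizukiFrdI2008, §0 p.12] -/
theorem mem_submonoid_primeOf_iff (i : ι) (a : directSum M) :
    a ∈ (primeOf hM i).submonoid ↔ dsupp (a : ∀ j, M j) ⊆ {i} := by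
  constructor
  · intro ha
    induction ha using Submonoid.closure_induction with
    | mem x hx => exact ((mem_carrier_primeOf_iff hM i x).mp hx).le
    | one => intro j hj; exact (hj rfl).elim
    | mul x y _ _ hx hy =>
      rw [coe_mul]
      exact (dsupp_mul_subset _ _).trans (Set.union_subset hx hy)
  · intro hs
    by_cases ha : a = 1
    · rw [ha]; exact Submonoid.one_mem _
    · apply Submonoid.subset_closure
      rw [mem_carrier_primeOf_iff]
      obtain ⟨j, hj⟩ := (ne_one_iff_dsupp_nonempty a).mp ha
      have : j = i := hs hj
      subst this
      exact Set.Subset.antisymm hs (Set.singleton_subset_iff.mpr hj)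

/-- **`(⊕_i M_i)_𝔭 ≅ M_i`** for the prime `𝔭` of `i`: `a ↦ a_i` (stated with an equation `primeOf i = 𝔭` to
avoid index transport). [cite: MochizukiFrdI2008, §0 p.12] -/
def submonoidEquiv (P : Primes (directSum M)) (i : ι) (e : primeOf hM i = P) : ↥P.submonoid ≃* M i where
  toFun x := (x.1 : ∀ j, M j) i
  invFun y := ⟨single i y, by rw [← e, mem_submonoid_primeOf_iff]; exact dsupp_single_subset i y⟩
  left_inv x := by
    have hx : dsupp (x.1 : ∀ j, M j) ⊆ {i} := by rw [← mem_submonoid_primeOf_iff hM, e]; exact x.2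
    exact Subtype.ext (eq_single_of_dsupp_subset hx).symm
  right_inv y := single_apply_same i y
  map_mul' x y := rfl

/-- **Every `(⊕_i M_i)_𝔭` is monoprime** (it is `≅ M_{idx 𝔭}`): condition (b) of Def. 2.4 (i) for `⊕_i M_i`.
[cite: MochizukiFrdI2008, Def. 2.4(i) p.47] -/
theorem isMonoprime_submonoid (P : Primes (directSum M)) : IsMonoprime ↥P.submonoid :=
  IsMonoprime.of_mulEquiv_univ (submonoidEquiv hM P (idx hM P) (primeOf_idx hM P)).symm (hM (idx hM P))

/-- Every index is the support of the prime it defines: `i ∈ supp a` for every `a` in the subset of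
`primeOf i`. [cite: MochizukiFrdI2008, §0 p.12] -/
theorem mem_dsupp_of_mem_carrier {i : ι} {a : directSum M} (ha : a ∈ (primeOf hM i).carrier) :
    i ∈ dsupp (a : ∀ j, M j) := by
  rw [(mem_carrier_primeOf_iff hM i a).mp ha]
  rfl

end DirectSum

end Literature.AlgebraicGeometry.Frobenioids
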